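import Literature.Barriers.CriticalPhenomena.TimarBoxesGood
import Literature.Probability.Percolation.HalfSpaceBGN
import HarnessLib

/-!
# Timár 2006, proof of Thm. 4.3: the good event is automorphism-covariant, hence equally
# likely at every vertex; it is local (measurable) — PROVED

Barrier catalogue `Literature/Barriers/CriticalPhenomena/`; continues `TimarBoxesGood.lean`
towards `Timar2006_noInfiniteLightClusters_holds`. Á. Timár, Ann. Probab. 34 (2006) 2344–2364,
proof of Thm. 4.3, p. 2354: "Note that the probability of `F(x) =: F` is independent of `x`
because these events can be mapped into each other by some automorphisms and our probability
measure is invariant under automorphisms" and "Clearly, there is also a uniform choice, so that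
`B_x(i; r)` is good for any `x` below `o`" [with the same probability]. Formally: an automorphism
`γ` carries the box data of `x` in `ω` onto the box data of `γ x` in `γ ω`
(`timarBoxCluster_relabel`, `timarSealed_relabel_iff`, `timarCountSet_relabel`), so
`γ ω ∈ timarGood (γ x) ↔ ω ∈ timarGood x` (`relabel_mem_timarGood_iff`) and, `P_p` being
`Aut(G)`-invariant (`bondPercolation_real_preimage_relabel_iso`), `P_p(timarGood x)` does not
depend on `x` on a transitive graph (`bondPercolation_real_timarGood_eq`). The good event is
determined by the edges of a ball, hence measurable (`measurableSet_timarGood`).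

## References

* Á. Timár, Ann. Probab. 34 (2006) 2344–2364 (arXiv:math/0702875), §4, proof of Thm. 4.3,
  p. 2354. [Timar2006]
* G. Grimmett, *Percolation*, 2nd ed., Springer 1999, §1.6 (invariance of `P_p`). [Grimmett1999]
-/

noncomputable section

namespace Literature.Barriers.CriticalPhenomena

open _root_.MeasureTheory Literature.Probability.Percolation
open scoped _root_.ENNReal

variable {V : Type*}

section Invariance

variable {G : SimpleGraph V} [G.LocallyFinite] {o : V} (hconn : G.Connected)
include hconn

/-- **Automorphisms rescale all weights by one constant**: `w(γ v) = w(γ o) · w(v)`.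
[cite: Timar2006, §5 (automorphisms act on weights by a constant factor)] -/
theorem autWeight_map_eq (γ : G ≃g G) (v : V) :
    autWeight G o (γ v) = autWeight G o (γ o) * autWeight G o v := by
  have h := autWeight_map_mul G hconn γ o v o
  rwa [autWeight_self G hconn o, mul_one] at h

/-- Weight comparisons are transported by automorphisms: `a w(γ x) < w(γ v) ↔ a w(x) < w(v)`.
[folklore] -/
theorem mul_autWeight_map_lt_iff (γ : G ≃g G) (a : ℝ≥0∞) (x v : V) :
    a * autWeight G o (γ x) < autWeight G o (γ v) ↔ a * autWeight G o x < autWeight G o v := by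
  rw [autWeight_map_eq hconn γ x, autWeight_map_eq hconn γ v, mul_left_comm]
  exact ENNReal.mul_lt_mul_iff_right (autWeight_ne_zero G hconn o _) (autWeight_ne_top G hconn o _)

/-- Likewise `w(γ v) ≤ a w(γ x) ↔ w(v) ≤ a w(x)`. [folklore] -/
theorem autWeight_map_le_mul_iff (γ : G ≃g G) (a : ℝ≥0∞) (x v : V) :
    autWeight G o (γ v) ≤ a * autWeight G o (γ x) ↔ autWeight G o v ≤ a * autWeight G o x := by
  rw [autWeight_map_eq hconn γ x, autWeight_map_eq hconn γ v, mul_left_comm]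
  exact ENNReal.mul_le_mul_iff_right (autWeight_ne_zero G hconn o _) (autWeight_ne_top G hconn o _)

/-- And `w(γ v) = a w(γ x) ↔ w(v) = a w(x)`. [folklore] -/
theorem autWeight_map_eq_mul_iff (γ : G ≃g G) (a : ℝ≥0∞) (x v : V) :
    autWeight G o (γ v) = a * autWeight G o (γ x) ↔ autWeight G o v = a * autWeight G o x := by
  rw [autWeight_map_eq hconn γ x, autWeight_map_eq hconn γ v, mul_left_comm]
  exact (ENNReal.mul_right_inj (autWeight_ne_zero G hconn o _) (autWeight_ne_top G hconn o _))

omit [G.LocallyFinite] hconn in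
/-- Automorphisms map balls onto balls: `γ v ∈ B(γ x, ρ) ↔ v ∈ B(x, ρ)`. [folklore] -/
theorem mem_graphBall_map_iff (γ : G ≃g G) {x v : V} {ρ : ℕ} :
    γ v ∈ graphBall G (γ x) ρ ↔ v ∈ graphBall G x ρ := by
  refine ⟨fun h => ?_, mem_graphBall_map γ⟩
  have h' := mem_graphBall_map γ.symm h
  rwa [RelIso.symm_apply_apply, RelIso.symm_apply_apply] at h'

/-- **Automorphisms carry relative boxes to relative boxes**: `γ v ∈ box(γ x, ρ, s w(γ x))`
iff `v ∈ box(x, ρ, s w(x))`. [cite: Timar2006, §4 (proof of Thm. 4.3: "One can define G′(x) … as the image of G′(o) by some … automorphism")] -/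
theorem map_mem_timarBox_iff (γ : G ≃g G) (x : V) (ρ : ℕ) (s : ℝ≥0∞) (v : V) :
    γ v ∈ timarBox G o (γ x) ρ (s * autWeight G o (γ x)) ↔
      v ∈ timarBox G o x ρ (s * autWeight G o x) := by
  simp only [mem_timarBox_iff, γ.injective.eq_iff, mem_graphBall_map_iff γ,
    mul_autWeight_map_lt_iff hconn γ, autWeight_map_le_mul_iff hconn γ]

/-- The box graphs correspond under `γ`. [folklore] -/
theorem timarBoxGraph_map_adj_iff (γ : G ≃g G) (x : V) (ρ : ℕ) (s : ℝ≥0∞) (u v : V) :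
    (timarBoxGraph G o (γ x) ρ (s * autWeight G o (γ x))).Adj (γ u) (γ v) ↔
      (timarBoxGraph G o x ρ (s * autWeight G o x)).Adj u v := by
  simp only [timarBoxGraph, withinGraph_adj, map_mem_timarBox_iff hconn γ, γ.map_adj_iff]

/-- **The box component of `γ x` in `γ ω` is the `γ`-image of the box component of `x` in `ω`.**
[cite: Timar2006, §4 (proof of Thm. 4.3: F(x) is the image of F(o) under an automorphism)] -/
theorem timarBoxCluster_relabel (γ : G ≃g G) (x : V) (ρ : ℕ) (s : ℝ≥0∞) (ω : BondConfig V) :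
    timarBoxCluster G o (γ x) ρ (s * autWeight G o (γ x))
        (BondConfig.relabel (sym2Equiv γ.toEquiv) ω) =
      γ '' timarBoxCluster G o x ρ (s * autWeight G o x) ω :=
  openClusterIn_relabel γ.toEquiv (timarBoxGraph_map_adj_iff hconn γ x ρ s) ω x

/-- Sealing is transported by automorphisms (one direction). [folklore] -/
theorem timarSealed_relabel (γ : G ≃g G) {x : V} {ρ : ℕ} {s : ℝ≥0∞} {ω : BondConfig V}
    (h : TimarSealed G o x ρ (s * autWeight G o x) ω) :
    TimarSealed G o (γ x) ρ (s * autWeight G o (γ x)) (BondConfig.relabel (sym2Equiv γ.toEquiv) ω) := by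
  intro v hv hvx u hadj hopen hsu
  rw [timarBoxCluster_relabel hconn γ x ρ s ω] at hv
  obtain ⟨v₀, hv₀, rfl⟩ := hv
  obtain ⟨u₀, rfl⟩ : ∃ u₀, γ u₀ = u := ⟨γ.symm u, γ.apply_symm_apply u⟩
  have hvx₀ : v₀ ≠ x := fun h => hvx (h ▸ rfl)
  rw [γ.map_adj_iff] at hadj
  have hopen' : s(v₀, u₀) ∈ ω := (mk_mem_relabel_iff γ.toEquiv ω v₀ u₀).1 hopen
  rw [mul_autWeight_map_lt_iff hconn γ] at hsu
  exact (map_mem_timarBox_iff hconn γ x ρ s u₀).2 (h hv₀ hvx₀ hadj hopen' hsu)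

omit [G.LocallyFinite] hconn in
/-- Relabelling by `γ⁻¹` undoes relabelling by `γ`. [folklore] -/
theorem relabel_symm_relabel (γ : G ≃g G) (ω : BondConfig V) :
    BondConfig.relabel (sym2Equiv γ.symm.toEquiv) (BondConfig.relabel (sym2Equiv γ.toEquiv) ω) = ω := by
  change (sym2Equiv γ.toEquiv).symm '' ((sym2Equiv γ.toEquiv) '' ω) = ω
  exact Equiv.symm_image_image _ ω

/-- **Sealing is automorphism-covariant.** [cite: Timar2006, §4 (proof of Thm. 4.3, p. 2354)] -/
theorem timarSealed_relabel_iff (γ : G ≃g G) (x : V) (ρ : ℕ) (s : ℝ≥0∞) (ω : BondConfig V) :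
    TimarSealed G o (γ x) ρ (s * autWeight G o (γ x)) (BondConfig.relabel (sym2Equiv γ.toEquiv) ω) ↔
      TimarSealed G o x ρ (s * autWeight G o x) ω := by
  refine ⟨fun h => ?_, timarSealed_relabel hconn γ⟩
  have h' := timarSealed_relabel hconn γ.symm h
  rwa [relabel_symm_relabel, RelIso.symm_apply_apply] at h'

/-- The open-long-edge condition is automorphism-covariant. [folklore] -/
theorem timarSteepOpen_relabel_iff (γ : G ≃g G) (y : V) (ω : BondConfig V) :
    TimarSteepOpen G o (γ y) (BondConfig.relabel (sym2Equiv γ.toEquiv) ω) ↔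
      TimarSteepOpen G o y ω := by
  constructor
  · rintro ⟨u, hadj, hw, hopen⟩
    obtain ⟨u₀, rfl⟩ : ∃ u₀, γ u₀ = u := ⟨γ.symm u, γ.apply_symm_apply u⟩
    rw [γ.map_adj_iff] at hadj
    have hopen' : s(y, u₀) ∈ ω := (mk_mem_relabel_iff γ.toEquiv ω y u₀).1 hopen
    rw [autWeight_map_eq_mul_iff hconn γ] at hw
    exact ⟨u₀, hadj, hw, hopen'⟩
  · rintro ⟨u, hadj, hw, hopen⟩
    exact ⟨γ u, (γ.map_adj_iff).2 hadj, (autWeight_map_eq_mul_iff hconn γ _ _ _).2 hw,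
      (mk_mem_relabel_iff γ.toEquiv ω y u).2 hopen⟩

/-- **The counted set of `γ x` in `γ ω` is the `γ`-image of the counted set of `x` in `ω`.**
[cite: Timar2006, §4 (proof of Thm. 4.3, p. 2354)] -/
theorem timarCountSet_relabel (γ : G ≃g G) (n ρ : ℕ) (x : V) (ω : BondConfig V) :
    timarCountSet G o n ρ (γ x) (BondConfig.relabel (sym2Equiv γ.toEquiv) ω) =
      γ '' timarCountSet G o n ρ x ω := by
  ext v
  simp only [timarCountSet, Set.mem_setOf_eq, Set.mem_image]
  rw [timarBoxCluster_relabel hconn γ x ρ _ ω]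
  constructor
  · rintro ⟨⟨v₀, hv₀, rfl⟩, hw, hs⟩
    exact ⟨v₀, ⟨hv₀, (autWeight_map_le_mul_iff hconn γ _ _ _).1 hw,
      (timarSteepOpen_relabel_iff hconn γ v₀ ω).1 hs⟩, rfl⟩
  · rintro ⟨v₀, ⟨hv₀, hw, hs⟩, rfl⟩
    exact ⟨⟨v₀, hv₀, rfl⟩, (autWeight_map_le_mul_iff hconn γ _ _ _).2 hw,
      (timarSteepOpen_relabel_iff hconn γ v₀ ω).2 hs⟩

/-- **The good event is automorphism-covariant**: `γ ω ∈ timarGood (γ x) ↔ ω ∈ timarGood x`.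
[cite: Timar2006, §4 (proof of Thm. 4.3: "these events can be mapped into each other by some automorphisms")] -/
theorem relabel_mem_timarGood_iff (γ : G ≃g G) (n r k : ℕ) (x : V) (ω : BondConfig V) :
    BondConfig.relabel (sym2Equiv γ.toEquiv) ω ∈ timarGood G o n r k (γ x) ↔
      ω ∈ timarGood G o n r k x := by
  simp only [timarGood, Set.mem_setOf_eq, timarSealed_relabel_iff hconn γ,
    timarCountSet_relabel hconn γ, γ.injective.injOn.encard_image]

/-- Preimage form: `(γ·)⁻¹' timarGood (γ x) = timarGood x`. [folklore] -/
theorem relabel_preimage_timarGood (γ : G ≃g G) (n r k : ℕ) (x : V) :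
    BondConfig.relabel (sym2Equiv γ.toEquiv) ⁻¹' timarGood G o n r k (γ x) = timarGood G o n r k x :=
  Set.ext fun ω => relabel_mem_timarGood_iff hconn γ n r k x ω

/-- **`P_p(timarGood x)` does not depend on `x`** on a transitive graph ("the probability of
`F(x) =: F` is independent of `x` … our probability measure is invariant under automorphisms",
p. 2354). [cite: Timar2006, §4 (proof of Thm. 4.3, p. 2354)] -/
theorem bondPercolation_real_timarGood_eq (htr : IsGraphTransitive G) (p : unitInterval)
    (n r k : ℕ) (x y : V) :
    (bondPercolation G p).real (timarGood G o n r k x) =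
      (bondPercolation G p).real (timarGood G o n r k y) := by
  obtain ⟨γ, rfl⟩ := htr x y
  rw [← relabel_preimage_timarGood hconn γ n r k x, bondPercolation_real_preimage_relabel_iso γ p]

end Invariance

/-! ### The good event is local, hence measurable -/

section Local

variable {G : SimpleGraph V} [G.LocallyFinite] {o : V}

/-- The good event of `x` is determined by the edges inside `B(x, r + 2)`.
[cite: Timar2006, §4 (proof of Thm. 4.3: goodness is decided inside B_x(i; r))] -/
theorem determinedBy_timarGood (n r k : ℕ) (x : V) :
    DeterminedBy (timarGood G o n r k x) (ballEdgeSet G x (r + 2)) := by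
  rw [determinedBy_iff]
  intro ω ω' h
  rw [← timarGood_inter_ballEdgeSet n r k x ω, h, timarGood_inter_ballEdgeSet]

/-- The good event is measurable. [folklore] -/
theorem measurableSet_timarGood (n r k : ℕ) (x : V) : MeasurableSet (timarGood G o n r k x) := by
  have h := determinedBy_timarGood (G := G) (o := o) n r k x
  rw [← (ballEdgeSet_finite (G := G) x (r + 2)).coe_toFinset] at h
  exact h.measurableSet_of_finset

/-- `p ↦ P_p(timarGood x)` is continuous (a local event: its probability is a polynomial in `p`;
"If `p̃` is sufficiently close to `p_c`, then the Bernoulli(`p̃`) component of `x` in `B_x(i; r)`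
is still good with probability `> q/2`, whatever `x` is. This is true because there is a uniform
bound on the sizes of the `B_x`", p. 2354). [cite: Timar2006, §4 (proof of Thm. 4.3, p. 2354)] -/
theorem continuous_bondPercolation_real_timarGood (n r k : ℕ) (x : V) :
    Continuous fun p : unitInterval => (bondPercolation G p).real (timarGood G o n r k x) := by
  have h := determinedBy_timarGood (G := G) (o := o) n r k x
  rw [← (ballEdgeSet_finite (G := G) x (r + 2)).coe_toFinset] at h
  exact continuous_bondPercolation_real_of_determinedBy G h

end Local

end Literature.Barriers.CriticalPhenomena

end
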